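import Summits.NavierStokesRegularity.FunctionalMining.PalinstrophyLadder
import Summits.NavierStokesRegularity.FunctionalMining.PalinstrophyRefutation
import Literature.Analysis.FluidPDE.TorusPalinstrophyLadder
import Mathlib.Analysis.MeanInequalities
import HarnessLib

/-!
# Functional mining: the palinstrophy ladder law holds — L1–L4 discharged, K1-Q0(𝒫) settled

Search for candidate a priori estimates; no regularity claim.

Cell `pub-nsfunc` (host summit NavierStokesRegularity, topic `FunctionalMining`), prove seat. The
dictionary's `PalinstrophyLadder.lean` types four prover targets whose conjunction gives, by its
PROVED assembly `palinstrophyLadderLaw_of_bounds`, the palinstrophy saturating law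
`d𝒫/dt ≤ κ ν^{-5/3} (2ℰ) 𝒫^{4/3}` (`𝒫 = ‖Δu‖₂²`) for every `κ ≥ κ_A =
(3/256)(5/2)^{5/3}(6√2/π)^{8/3} ≈ 0.7635`, along every zero-mean classical solution of unforced
Navier–Stokes on `T³`. This file discharges all four:

* L1 `palinstrophyProductionSupBound_holds`, L2 `gradientAgmonBound_holds`,
  L3 `palinstrophyInterpolation_holds` — one-line wrappers of the tree's Doering–Gibbon ladder file
  `FluidPDE/TorusPalinstrophyLadder` (`Torus.abs_integral_inner_convect_bilaplacian_le`,
  `Torus.sum_norm_sq_partialDeriv_le_agmon_explicit`, `Torus.sq_integral_norm_sq_laplacian_le`;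
  Doering–Gibbon 1995 Thm 6.1 at `N = 2`, Ayala 2014 App. A);
* L4 `ladderRealIneq_holds` — the real inequality
  `(6√2/π) P^{5/4} D^{1/4} − 2νD ≤ κ_A ν^{-5/3} E P^{4/3}` under `P² ≤ E D`, by the weighted
  AM–GM inequality `u^{5/8} w^{3/8} ≤ (5/8)u + (3/8)w` (Mathlib
  `Real.geom_mean_le_arith_mean2_weighted`) with `u = (16/5)νD²`, `w = (8/3)κ_A ν^{-5/3}P^{10/3}`,
  and the constant identity `(16/5)^{5/8}((8/3)κ_A)^{3/8} = 6√2/π` (`ladderConst_identity`, eighth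
  powers);

hence `palinstrophyLadderLaw : PalinstrophyLadderLaw`, `palinstrophySaturatingLaw_ladderConst`,
`not_palinstrophySaturationFails` — UNCONDITIONAL. Together with `PalinstrophyRefutation.lean`
(no budget of Navier–Stokes degree `< 5` for `𝒫`) this pins the palinstrophy row of the census:
the true law sits exactly on the Sieve-1 boundary (degree `1 + 4 = 5`). A small-data / a-priori-shape
statement; nothing about regularity. No definitions.
-/

noncomputable section

open Set MeasureTheory
open scoped InnerProductSpace RealInnerProductSpace

namespace Summit.NavierStokesRegularity.FunctionalMining

open Literature.Analysis.FunctionSpaces Literature.Analysis.FluidPDE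

variable {d : Type*} [Fintype d] [DecidableEq d]

/-! ## L1, L2, L3 from the tree's Doering–Gibbon ladder file -/

/-- **L1 holds**: `N(v) ≤ 3M𝒫(v)` under `Σᵢ‖∂ᵢv‖² ≤ M²` pointwise — the tree's
`Torus.abs_integral_inner_convect_bilaplacian_le` (Doering–Gibbon 1995 (6.2.25), `N = 2`, any
dimension). [cite: DoeringGibbon1995, §6.2, proof of Thm 6.1, Step 2, eq. (6.2.25) (N = 2)] -/
theorem palinstrophyProductionSupBound_holds : PalinstrophyProductionSupBound (d := d) := by
  intro _ v hv hdiv M hM hgrad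
  have h := Literature.Analysis.FunctionSpaces.Torus.abs_integral_inner_convect_bilaplacian_le hv hdiv hM hgrad
  unfold palinstrophyProduction torusPalinstrophy
  have := neg_abs_le (∫ x, ⟪Torus.convect v v x, Torus.laplacian (Torus.laplacian v) x⟫_ℝ)
  linarith

/-- **L2 holds**: Agmon for the gradient with the explicit constant `2/π²` — the tree's
`Torus.sum_norm_sq_partialDeriv_le_agmon_explicit` (Ayala 2014, App. A). [cite: Ayala2014Thesis, App. A (A.3)] -/
theorem gradientAgmonBound_holds : GradientAgmonBound (d := d) := by
  intro hd v hv x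
  exact Literature.Analysis.FunctionSpaces.Torus.sum_norm_sq_partialDeriv_le_agmon_explicit hd hv x

/-- **L3 holds**: `𝒫² ≤ (2ℰ)·D₃` — the tree's `Torus.sq_integral_norm_sq_laplacian_le`
(Doering–Gibbon 1995, Lemma 6.2 at `N = 2`). [cite: DoeringGibbon1995, §6.2 Lemma 6.2, eqs. (6.2.30)–(6.2.31) (N = 2)] -/
theorem palinstrophyInterpolation_holds : PalinstrophyInterpolation (d := d) := by
  intro v hv
  have h := Literature.Analysis.FunctionSpaces.Torus.sq_integral_norm_sq_laplacian_le hv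
  unfold torusPalinstrophy palinstrophyDissipation
  rw [show 2 * torusEnstrophy v = Torus.gradNormSq v by
    rw [gradNormSq_eq_two_mul_torusEnstrophy]]
  exact h

/-! ## L4: the real inequality (weighted AM–GM with exponents `5/8`, `3/8`) -/

/-- `(x ^ r) ^ n = x ^ (r * n)` for `x ≥ 0`, natural `n`. [folklore] -/
theorem rpow_rpow_natCast {x : ℝ} (hx : 0 ≤ x) (r : ℝ) (n : ℕ) :
    (x ^ r) ^ n = x ^ (r * n) := by
  rw [← Real.rpow_natCast, ← Real.rpow_mul hx]

/-- The constant identity behind L4: `(16/5)^{5/8} · ((8/3) κ_A)^{3/8} = 6√2/π`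
(eighth powers: `(16/5)⁵ · ((8/3)κ_A)³ = (6√2/π)⁸`, using `κ_A = (3/256)(5/2)^{5/3}(6√2/π)^{8/3}`).
[folklore] -/
theorem ladderConst_identity :
    (16 / 5 : ℝ) ^ (5 / 8 : ℝ) * (8 / 3 * palinstrophyLadderConst) ^ (3 / 8 : ℝ) =
      6 * (Real.sqrt 2 / Real.pi) := by
  set a : ℝ := 6 * (Real.sqrt 2 / Real.pi) with ha
  have ha0 : 0 < a := by rw [ha]; positivity
  have hκ : palinstrophyLadderConst = 3 / 256 * (5 / 2 : ℝ) ^ (5 / 3 : ℝ) * a ^ (8 / 3 : ℝ) := rfl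
  have hκ0 : 0 ≤ 8 / 3 * palinstrophyLadderConst := by rw [hκ]; positivity
  have hL0 : 0 ≤ (16 / 5 : ℝ) ^ (5 / 8 : ℝ) * (8 / 3 * palinstrophyLadderConst) ^ (3 / 8 : ℝ) := by
    positivity
  -- eighth powers of the three real powers involved
  have h1 : ((16 / 5 : ℝ) ^ (5 / 8 : ℝ)) ^ 8 = (16 / 5 : ℝ) ^ 5 := by
    rw [rpow_rpow_natCast (by norm_num) (5 / 8) 8,
      show (5 / 8 : ℝ) * (8 : ℕ) = ((5 : ℕ) : ℝ) by norm_num, Real.rpow_natCast]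
  have h2 : ((8 / 3 * palinstrophyLadderConst) ^ (3 / 8 : ℝ)) ^ 8 =
      (8 / 3 * palinstrophyLadderConst) ^ 3 := by
    rw [rpow_rpow_natCast hκ0 (3 / 8) 8,
      show (3 / 8 : ℝ) * (8 : ℕ) = ((3 : ℕ) : ℝ) by norm_num, Real.rpow_natCast]
  have h53 : ((5 / 2 : ℝ) ^ (5 / 3 : ℝ)) ^ 3 = (5 / 2 : ℝ) ^ 5 := by
    rw [rpow_rpow_natCast (by norm_num) (5 / 3) 3,
      show (5 / 3 : ℝ) * (3 : ℕ) = ((5 : ℕ) : ℝ) by norm_num, Real.rpow_natCast]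
  have h83 : (a ^ (8 / 3 : ℝ)) ^ 3 = a ^ 8 := by
    rw [rpow_rpow_natCast ha0.le (8 / 3) 3,
      show (8 / 3 : ℝ) * (3 : ℕ) = ((8 : ℕ) : ℝ) by norm_num, Real.rpow_natCast]
  -- compare eighth powers
  rw [← pow_left_inj₀ hL0 ha0.le (by norm_num : (8 : ℕ) ≠ 0), mul_pow, h1, h2, hκ]
  have : (8 / 3 * (3 / 256 * (5 / 2 : ℝ) ^ (5 / 3 : ℝ) * a ^ (8 / 3 : ℝ))) ^ 3 =
      (8 / 3 * (3 / 256)) ^ 3 * ((5 / 2 : ℝ) ^ (5 / 3 : ℝ)) ^ 3 * (a ^ (8 / 3 : ℝ)) ^ 3 := by ring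
  rw [this, h53, h83]
  norm_num
  ring

/-- **L4 holds**: for `P, D, E ≥ 0`, `ν > 0`, `P² ≤ E·D`:
`(6√2/π) P^{5/4} D^{1/4} − 2νD ≤ κ_A ν^{-5/3} E P^{4/3}`. Proof: for `D > 0`, weighted AM–GM
`u^{5/8} w^{3/8} ≤ (5/8)u + (3/8)w` with `u = (16/5)νD²`, `w = (8/3)κ_A ν^{-5/3} P^{10/3}` gives
`(6√2/π)(PD)^{5/4} ≤ 2νD² + κ_A ν^{-5/3} P^{10/3}` (`ladderConst_identity`); divide by `D` and use
`P^{10/3} = P² P^{4/3} ≤ E D P^{4/3}`. [folklore] -/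
theorem ladderRealIneq_holds : LadderRealIneq := by
  intro P D E ν hP hD hE hν hPED
  set a : ℝ := 6 * (Real.sqrt 2 / Real.pi) with ha
  set κ := palinstrophyLadderConst with hκdef
  have ha0 : 0 < a := by rw [ha]; positivity
  have hκ0 : 0 < κ := by
    rw [hκdef, palinstrophyLadderConst]; positivity
  have hνr : ∀ r : ℝ, 0 < ν ^ r := fun r => Real.rpow_pos_of_pos hν r
  rcases hD.eq_or_lt with hD0 | hDpos
  · -- `D = 0`: the left side vanishes
    rw [← hD0, Real.zero_rpow (by norm_num), mul_zero, mul_zero, sub_zero]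
    have : 0 ≤ κ * ν ^ (-(5 / 3 : ℝ)) * E * P ^ (4 / 3 : ℝ) := by
      have := hνr (-(5 / 3)); positivity
    linarith
  -- weighted AM–GM
  set u : ℝ := 16 / 5 * ν * D ^ 2 with hu
  set w : ℝ := 8 / 3 * κ * (ν ^ (-(5 / 3 : ℝ)) * P ^ (10 / 3 : ℝ)) with hw
  have hu0 : 0 ≤ u := by positivity
  have hw0 : 0 ≤ w := by have := hνr (-(5 / 3)); positivity
  have hAM := Real.geom_mean_le_arith_mean2_weighted (by norm_num : (0 : ℝ) ≤ 5 / 8)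
    (by norm_num : (0 : ℝ) ≤ 3 / 8) hu0 hw0 (by norm_num : (5 / 8 : ℝ) + 3 / 8 = 1)
  -- left side of AM–GM: `u^{5/8} w^{3/8} = a (P D)^{5/4}`... computed factor by factor
  have hu58 : u ^ (5 / 8 : ℝ) = (16 / 5 : ℝ) ^ (5 / 8 : ℝ) * ν ^ (5 / 8 : ℝ) * D ^ (5 / 4 : ℝ) := by
    rw [hu, Real.mul_rpow (by positivity) (by positivity), Real.mul_rpow (by norm_num) hν.le,
      show D ^ 2 = D ^ (2 : ℝ) by norm_cast, ← Real.rpow_mul hD]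
    norm_num
  have hw38 : w ^ (3 / 8 : ℝ) =
      (8 / 3 * κ) ^ (3 / 8 : ℝ) * ν ^ (-(5 / 8 : ℝ)) * P ^ (5 / 4 : ℝ) := by
    rw [hw, Real.mul_rpow (by positivity) (by have := hνr (-(5 / 3)); positivity),
      Real.mul_rpow (hνr _).le (Real.rpow_nonneg hP _), ← Real.rpow_mul hν.le, ← Real.rpow_mul hP]
    norm_num
    ring
  have hprod : u ^ (5 / 8 : ℝ) * w ^ (3 / 8 : ℝ) = a * P ^ (5 / 4 : ℝ) * D ^ (5 / 4 : ℝ) := by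
    rw [hu58, hw38]
    have hνν : ν ^ (5 / 8 : ℝ) * ν ^ (-(5 / 8 : ℝ)) = 1 := by
      rw [← Real.rpow_add hν]; norm_num
    have hc := ladderConst_identity
    rw [← hκdef, ← ha] at hc
    calc (16 / 5 : ℝ) ^ (5 / 8 : ℝ) * ν ^ (5 / 8 : ℝ) * D ^ (5 / 4 : ℝ) *
          ((8 / 3 * κ) ^ (3 / 8 : ℝ) * ν ^ (-(5 / 8 : ℝ)) * P ^ (5 / 4 : ℝ))
        = ((16 / 5 : ℝ) ^ (5 / 8 : ℝ) * (8 / 3 * κ) ^ (3 / 8 : ℝ)) *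
            (ν ^ (5 / 8 : ℝ) * ν ^ (-(5 / 8 : ℝ))) * (P ^ (5 / 4 : ℝ) * D ^ (5 / 4 : ℝ)) := by ring
      _ = a * P ^ (5 / 4 : ℝ) * D ^ (5 / 4 : ℝ) := by rw [hc, hνν]; ring
  -- right side of AM–GM
  have hrhs : 5 / 8 * u + 3 / 8 * w = 2 * ν * D ^ 2 + κ * ν ^ (-(5 / 3 : ℝ)) * P ^ (10 / 3 : ℝ) := by
    rw [hu, hw]; ring
  have key : a * P ^ (5 / 4 : ℝ) * D ^ (5 / 4 : ℝ) ≤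
      2 * ν * D ^ 2 + κ * ν ^ (-(5 / 3 : ℝ)) * P ^ (10 / 3 : ℝ) := by
    rw [← hprod, ← hrhs]; exact hAM
  -- divide by `D`: `D^{5/4} = D · D^{1/4}`, `P^{10/3} = P² · P^{4/3} ≤ E D P^{4/3}`
  have hD54 : D ^ (5 / 4 : ℝ) = D * D ^ (1 / 4 : ℝ) := by
    rw [show (5 / 4 : ℝ) = 1 + 1 / 4 by norm_num, Real.rpow_add hDpos, Real.rpow_one]
  have hP103 : P ^ (10 / 3 : ℝ) = P ^ 2 * P ^ (4 / 3 : ℝ) := by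
    rw [show (10 / 3 : ℝ) = 2 + 4 / 3 by norm_num, Real.rpow_add' hP (by norm_num),
      show P ^ (2 : ℝ) = P ^ 2 by norm_cast]
  have hP43 : 0 ≤ P ^ (4 / 3 : ℝ) := Real.rpow_nonneg hP _
  have h1 : κ * ν ^ (-(5 / 3 : ℝ)) * P ^ (10 / 3 : ℝ) ≤
      D * (κ * ν ^ (-(5 / 3 : ℝ)) * E * P ^ (4 / 3 : ℝ)) := by
    rw [hP103]
    have hk : 0 ≤ κ * ν ^ (-(5 / 3 : ℝ)) := by have := hνr (-(5 / 3)); positivity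
    have : κ * ν ^ (-(5 / 3 : ℝ)) * (P ^ 2 * P ^ (4 / 3 : ℝ)) ≤
        κ * ν ^ (-(5 / 3 : ℝ)) * (E * D * P ^ (4 / 3 : ℝ)) :=
      mul_le_mul_of_nonneg_left (mul_le_mul_of_nonneg_right hPED hP43) hk
    linarith [this]
  -- `D · (a P^{5/4} D^{1/4} − 2νD) ≤ D · (κ ν^{-5/3} E P^{4/3})`
  have h2 : D * (a * P ^ (5 / 4 : ℝ) * D ^ (1 / 4 : ℝ) - 2 * ν * D) ≤
      D * (κ * ν ^ (-(5 / 3 : ℝ)) * E * P ^ (4 / 3 : ℝ)) := by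
    have : D * (a * P ^ (5 / 4 : ℝ) * D ^ (1 / 4 : ℝ) - 2 * ν * D) =
        a * P ^ (5 / 4 : ℝ) * D ^ (5 / 4 : ℝ) - 2 * ν * D ^ 2 := by rw [hD54]; ring
    rw [this]
    linarith
  exact le_of_mul_le_mul_left h2 hDpos

/-! ## The palinstrophy ladder law, unconditionally -/

/-- **The palinstrophy ladder law HOLDS (K1-Q0(𝒫) settled): for every `κ ≥ κ_A =
(3/256)(5/2)^{5/3}(6√2/π)^{8/3} ≈ 0.7635`, `d𝒫/dt ≤ κ ν^{-5/3} (2ℰ) 𝒫^{4/3}` along every zero-mean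
classical solution of unforced Navier–Stokes on `T³`** (`𝒫 = ‖Δu‖₂²`). The dictionary's assembly
`palinstrophyLadderLaw_of_bounds` fed with L1–L4, all four now tree theorems: the `N = 2` rung of
the Doering–Gibbon ladder (1995, Thm 6.1) with Agmon's inequality in Ayala's explicit form and a
weighted AM–GM optimisation. A true budget of Navier–Stokes degree exactly `5` — the boundary left
open by the no-go `not_isRateBudget_palinstrophy_monomial` (`PalinstrophyRefutation.lean`:
nothing of degree `< 5` holds). Search for candidate a priori estimates; no regularity claim (a
small-data / a-priori-shape statement). [cite: DoeringGibbon1995, §6.2 Thm 6.1, eq. (6.2.27) (N = 2)] -/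
theorem palinstrophyLadderLaw : PalinstrophyLadderLaw (d := d) :=
  palinstrophyLadderLaw_of_bounds palinstrophyProductionSupBound_holds gradientAgmonBound_holds
    palinstrophyInterpolation_holds ladderRealIneq_holds

/-- **The palinstrophy saturating law at `κ_A`**: `d𝒫/dt ≤ κ_A ν^{-5/3} (2ℰ) 𝒫^{4/3}`. [folklore] -/
theorem palinstrophySaturatingLaw_ladderConst :
    PalinstrophySaturatingLaw (d := d) palinstrophyLadderConst :=
  palinstrophyLadderLaw _ le_rfl

/-- **K1-Q0(𝒫), negative edge refuted**: it is NOT the case that the palinstrophy saturating law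
fails for every rate constant. [folklore] -/
theorem not_palinstrophySaturationFails : ¬ PalinstrophySaturationFails (d := d) :=
  not_palinstrophySaturationFails_of_bounds palinstrophyProductionSupBound_holds
    gradientAgmonBound_holds palinstrophyInterpolation_holds ladderRealIneq_holds

end Summit.NavierStokesRegularity.FunctionalMining

end
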